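import Literature.Geometry.Riemannian.PinchingEstimatesTwoSmallestSum
import Literature.Geometry.Riemannian.PinchingEstimatesReduction6
import Literature.Geometry.Riemannian.HamiltonCurvatureODEProofs
import HarnessLib

/-!
# `a₁ + a₂ ≥ m` is preserved by the Ricci flow on a closed 4-manifold: discharge of Hamilton 1997, Thm. B1.2
(topic `Geometry/Riemannian`)

**Hamilton 1997, §2.1 (= Section B), Thm. 1.2**, Comm. Anal. Geom. 5, p. 7: "The Ricci flow on
a compact 4-manifold preserves positive isotropic curvature. For any constant `m > 0` the Ricci
flow preserves the inequalities `a₁ + a₂ ≥ m` and `c₁ + c₂ ≥ m`. Proof. From the ordinary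
differential inequalities in [3] `d/dt (a₁ + a₂) ≥ a₁² + a₂² + 2(a₁ + a₂)a₃ + b₁² + b₂²`. Now if
`a₁ + a₂ ≥ m > 0` then `a₃ > 0` also. The set `a₁ + a₂ ≥ m` is convex since `a₁ + a₂` is a
concave function of the matrix `A`. This proves the theorem for `A`, and `C` is the same."

The second sentence is the named fact
`Literature.Geometry.Riemannian.ricciFlow_preserves_twoSmallestEigenvaluesSum_ge`
(`PinchingEstimates.lean`). Its proof is assembled from the two halves already in the tree,
following the printed proof word for word:

* the ODE half and the reduction to "[3]" —
  `ricciFlow_preserves_twoSmallestEigenvaluesSum_ge_of_maximumPrinciple`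
  (`PinchingEstimatesTwoSmallestSum.lean`: Hamilton's differential inequality at a Ky Fan
  minimiser, `PinchingEstimatesKyFanMinimiser.lean`; forward invariance of the closed convex
  `B`-independent set `{A, C symmetric, a₁ + a₂ ≥ m, c₁ + c₂ ≥ m}` under Hamilton's ODE; the
  blocks of `g(0)` lie in it);
* "[3]" = Hamilton 1986, §4, Thm. 4.3, the maximum principle for systems applied to the
  curvature ODE of the Ricci flow — `hamilton_maximumPrinciple_curvatureODE_holds`
  (`HamiltonCurvatureODEProofs.lean`).

* `ricciFlow_preserves_twoSmallestEigenvaluesSum_ge_holds :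
    ricciFlow_preserves_twoSmallestEigenvaluesSum_ge`.

No definitions are introduced.

## Chen–Zhu 2006, Lemma 2.1 (= Hamilton 1997, Thm. B1.1 + Thm. B2.3): discharge of `hamilton_chenZhu_pinching`

**Chen–Zhu 2006, §2, Lemma 2.1** (arXiv:math/0504478, p. 4; = Hamilton 1997, §2,
Thm. 1.1, i.e. Thms. B1.1 and B2.3): the pinching estimates (2.1)–(2.3) with constants depending
only on the initial metric hold along the Ricci flow on a compact four-manifold with positive
isotropic curvature — the named fact `Literature.Geometry.Riemannian.hamilton_chenZhu_pinching`
(`PinchingEstimates.lean`). The whole of Hamilton 1997, §2.1–2.2 (Thms. 1.2–1.9, 2.1–2.3, the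
convexity of the pinching sets, the compactness of the initial data) is reduced in the tree to
Hamilton's maximum principle for the curvature ODE,
`hamilton_chenZhu_pinching_of_maximumPrinciple` (`PinchingEstimatesReduction6.lean`); fed with
`hamilton_maximumPrinciple_curvatureODE_holds` (Hamilton 1986, §4, Thm. 4.3 / Chow–Lu 2004,
Thm. 3; `HamiltonCurvatureODEProofs.lean`) it gives

* `hamilton_chenZhu_pinching_holds : hamilton_chenZhu_pinching`.

## References

* B.-L. Chen, X.-P. Zhu, *Ricci flow with surgery on four-manifolds with positive isotropic
  curvature*, J. Differential Geom. 74 (2006) 177–264, §2, Lemma 2.1. [ChenZhu2006]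
* B. Chow, P. Lu, *The time-dependent maximum principle for systems of parabolic equations subject
  to an avoidance set*, Pacific J. Math. 214 (2004) 201–222, §2, Thm. 3. [ChowLu2004]

* R. S. Hamilton, *Four-manifolds with positive isotropic curvature*, Comm. Anal. Geom. 5 (1997)
  1–92, §2.1, Thm. 1.2 and its proof (p. 7). [Hamilton1997]
* R. S. Hamilton, *Four-manifolds with positive curvature operator*, J. Differential Geom. 24
  (1986) 153–179, §4, Thm. 4.3 (p. 162) and §6 (p. 166). [Hamilton1986]
-/

noncomputable section

namespace Literature.Geometry.Riemannian

universe u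

/-- **Hamilton 1997, §2.1, Thm. 1.2 (= Thm. B1.2), second sentence**: "For any constant `m > 0`
the Ricci flow preserves the inequalities `a₁ + a₂ ≥ m` and `c₁ + c₂ ≥ m`" — the named fact
`ricciFlow_preserves_twoSmallestEigenvaluesSum_ge` holds (for every Ricci flow of Riemannian
metrics on `[0, T)` on a closed smooth 4-manifold, frame-wise, in the Ky Fan form of
`a₁ + a₂ ≥ m`). Proof exactly as printed (p. 7): the reduction
`ricciFlow_preserves_twoSmallestEigenvaluesSum_ge_of_maximumPrinciple` (the differential
inequality `d/dt (a₁ + a₂) ≥ a₁² + a₂² + 2(a₁ + a₂)a₃ + b₁² + b₂²` and the convexity of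
`{a₁ + a₂ ≥ m}`) fed with "the maximum principle for systems of [3]",
`hamilton_maximumPrinciple_curvatureODE_holds` (Hamilton 1986, §4, Thm. 4.3).
[cite: Hamilton1997, §2.1, Thm. 1.2 (p. 7)] [cite: Hamilton1986, §4, Thm. 4.3 (p. 162)] -/
theorem ricciFlow_preserves_twoSmallestEigenvaluesSum_ge_holds :
    ricciFlow_preserves_twoSmallestEigenvaluesSum_ge.{u} :=
  ricciFlow_preserves_twoSmallestEigenvaluesSum_ge_of_maximumPrinciple
    hamilton_maximumPrinciple_curvatureODE_holds

/-- **Chen–Zhu 2006, Lemma 2.1 (= Hamilton 1997, Thm. B1.1 + Thm. B2.3)** holds: along the Ricci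
flow on a compact four-manifold with positive isotropic curvature there are constants
`ρ, Λ, P < +∞` depending only on the initial metric with the pinching (2.1)–(2.3). Proof: the
reduction of Hamilton 1997, §2.1–2.2 to the maximum principle for the curvature ODE
(`hamilton_chenZhu_pinching_of_maximumPrinciple`) fed with Hamilton 1986, §4, Thm. 4.3
(`hamilton_maximumPrinciple_curvatureODE_holds`).
[cite: ChenZhu2006, §2, Lemma 2.1 (arXiv p. 4)] [cite: Hamilton1997, §2, Thm. 1.1 (Thms. B1.1, B2.3)]
[cite: Hamilton1986, §4, Thm. 4.3 (p. 162)] -/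
theorem hamilton_chenZhu_pinching_holds : hamilton_chenZhu_pinching.{u} :=
  hamilton_chenZhu_pinching_of_maximumPrinciple hamilton_maximumPrinciple_curvatureODE_holds

end Literature.Geometry.Riemannian

end
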